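import Summits.Ventures.HodgeRepro.FacePattern

/-!
# The face criterion: a `SumTwo` quadruple is a face iff two pairings are singletons; degrees 6 and 8

Blind re-derivation cell `pub-hodge-repro`, seat `typer` (gen 4).  Continues `FacePattern.lean` (the
pairing pattern `shared T i = T 0 ∩ T i` of a `SumTwo` quadruple and the corner equations).

* `shared_nonempty`: a corner sharing nothing with `T 0` is the conjugate type `c • T 0` — so without a
  conjugate corner all three pairings occur (`route/ROUTE.md` §3.1: "a missing pairing forces a corner
  equal to `Φ̄`");
* `shared_faceCorners_one/two/three`: the pattern of a face `(Φ; π, π′)` is `({π}, {π′}, Φ \\ {π, π′})`;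
* **`isFace_iff_two_singleton_shared`**: a quadruple is a face up to relabelling iff two of its pairings
  are singletons — so in degree 12, where the pattern is `(4,1,1)`, `(3,2,1)` or `(2,2,2)`
  (`sum_card_shared_of_card_twelve`), exactly the `(4,1,1)` quadruples are faces (§3.4);
* **`isFace_of_sumTwo_of_card_le_eight`**: for `|G| ≤ 8` (degrees 6 and 8: `|T 0| ≤ 4`, three
  non-empty parts, so two are singletons) every `SumTwo` quadruple of CM types with no corner conjugate
  to `T 0` is `faceCorners c (T 0) π π′` up to relabelling corners `1, 2, 3` — the census faces are ALL
  the (eq2)-quadruples without conjugate corners in degrees 6 and 8 (§3.1, §3.5 (ii));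
* `fin4_triples_mem`, `perm_fin4`: the relabelling as a `List.Perm`.

Everything holds for every finite group `G` with a complex conjugation `c`; the sealed instances are
`SexticComplete.lean` (degree 6, sealed coordinates) and `EngineComplete.lean` (the engine, `n ≤ 8`).
-/

open Finset
open scoped Pointwise symmDiff

namespace HodgeRepro

variable {G : Type*} [Group G] [DecidableEq G] [Fintype G]

/-! ### A missing pairing forces a conjugate corner -/

/-- **A missing pairing forces a conjugate corner**: if corner `i` shares no embedding with `T 0`, it is
the conjugate type `c • T 0`.  Contrapositive: without a conjugate corner every `shared T i` is non-empty. -/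
theorem shared_nonempty {c : G} (hc : IsComplexConj c) {T : Fin 4 → Finset G}
    (h0 : IsCMType c (T 0)) {i : Fin 4} (hi : IsCMType c (T i)) (hne : T i ≠ c • T 0) :
    (shared T i).Nonempty := by
  rw [Finset.nonempty_iff_ne_empty]
  intro hemp
  apply hne
  rw [h0.smul_eq_compl hc]
  ext x
  rw [Finset.mem_compl]
  constructor
  · intro hx hx0
    have : x ∈ shared T i := mem_shared.2 ⟨hx0, hx⟩
    rw [hemp] at this
    exact Finset.notMem_empty x this
  · intro hx0
    have hcx : c * x ∈ T 0 := (h0.conj_mem_iff x).2 hx0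
    have hcx' : c * x ∉ T i := fun h => by
      have : c * x ∈ shared T i := mem_shared.2 ⟨hcx, h⟩
      rw [hemp] at this
      exact Finset.notMem_empty _ this
    exact (hi x).2 hcx'

/-! ### The pattern of a face -/

/-- For a face `(Φ; p, p′)` with `p, p′ ∈ Φ` at distinct places, the first corner shares exactly `p` with
the corner `(Φ̄)^{(p)}`. -/
theorem shared_faceCorners_one {c : G} (hc : IsComplexConj c) {Φ : Finset G} (hΦ : IsCMType c Φ)
    {p p' : G} (hp : p ∈ Φ) : shared (faceCorners c Φ p p') 1 = {p} := by
  ext x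
  rw [mem_shared, Finset.mem_singleton]
  show x ∈ Φ ∧ x ∈ flipAt c p (c • Φ) ↔ x = p
  rw [mem_flipAt, hΦ.smul_eq_compl hc, Finset.mem_compl, mem_place]
  constructor
  · rintro ⟨hx, ⟨h1, -⟩ | ⟨h1 | h1, -⟩⟩
    · exact absurd hx h1
    · exact h1
    · exact absurd (h1 ▸ hx) (conj_not_mem_of_mem hΦ hp)
  · rintro rfl
    exact ⟨hp, Or.inr ⟨Or.inl rfl, not_not.2 hp⟩⟩

/-- The first corner shares exactly `p′` with the corner `(Φ̄)^{(p′)}`. -/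
theorem shared_faceCorners_two {c : G} (hc : IsComplexConj c) {Φ : Finset G} (hΦ : IsCMType c Φ)
    {p p' : G} (hp' : p' ∈ Φ) : shared (faceCorners c Φ p p') 2 = {p'} := by
  ext x
  rw [mem_shared, Finset.mem_singleton]
  show x ∈ Φ ∧ x ∈ flipAt c p' (c • Φ) ↔ x = p'
  rw [mem_flipAt, hΦ.smul_eq_compl hc, Finset.mem_compl, mem_place]
  constructor
  · rintro ⟨hx, ⟨h1, -⟩ | ⟨h1 | h1, -⟩⟩
    · exact absurd hx h1
    · exact h1
    · exact absurd (h1 ▸ hx) (conj_not_mem_of_mem hΦ hp')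
  · rintro rfl
    exact ⟨hp', Or.inr ⟨Or.inl rfl, not_not.2 hp'⟩⟩

/-! ### A quadruple is a face iff two pairings are singletons -/

/-- The third index: for distinct non-zero `a, b : Fin 4` there is a non-zero `d ≠ a, b`. -/
private theorem fin4_exists_third (a b : Fin 4) (ha : a ≠ 0) (hb : b ≠ 0) (hab : a ≠ b) :
    ∃ d : Fin 4, d ≠ 0 ∧ d ≠ a ∧ d ≠ b := by
  fin_cases a <;> fin_cases b <;>
    first
    | exact absurd rfl ha
    | exact absurd rfl hb
    | exact absurd rfl hab
    | exact ⟨3, by decide, by decide, by decide⟩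
    | exact ⟨2, by decide, by decide, by decide⟩
    | exact ⟨1, by decide, by decide, by decide⟩

/-- **A quadruple is a face up to relabelling iff two of its pairings are singletons** — so in degree
12, where the pairing pattern is `(4,1,1)`, `(3,2,1)` or `(2,2,2)`, exactly the `(4,1,1)` quadruples are
faces (`route/ROUTE.md` §3.4: the patterns `(3,2,1)` and `(2,2,2)` "are NOT census faces"). -/
theorem isFace_iff_two_singleton_shared {c : G} (hc : IsComplexConj c) {T : Fin 4 → Finset G}
    (hT : ∀ i, IsCMType c (T i)) (hsum : SumTwo T) :
    (∃ (a b d : Fin 4) (π π' : G), a ≠ 0 ∧ b ≠ 0 ∧ d ≠ 0 ∧ a ≠ b ∧ a ≠ d ∧ b ≠ d ∧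
      π ∈ T 0 ∧ π' ∈ T 0 ∧ π' ∉ place c π ∧
      T a = faceCorners c (T 0) π π' 1 ∧ T b = faceCorners c (T 0) π π' 2 ∧
      T d = faceCorners c (T 0) π π' 3) ↔
    ∃ a b : Fin 4, a ≠ 0 ∧ b ≠ 0 ∧ a ≠ b ∧ (shared T a).card = 1 ∧ (shared T b).card = 1 := by
  constructor
  · rintro ⟨a, b, d, π, π', ha, hb, hd, hab, had, hbd, hπ0, hπ'0, -, h1, h2, -⟩
    refine ⟨a, b, ha, hb, hab, ?_, ?_⟩
    · have : shared T a = shared (faceCorners c (T 0) π π') 1 := by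
        unfold shared; rw [h1]; rfl
      rw [this, shared_faceCorners_one hc (hT 0) hπ0, Finset.card_singleton]
    · have : shared T b = shared (faceCorners c (T 0) π π') 2 := by
        unfold shared; rw [h2]; rfl
      rw [this, shared_faceCorners_two hc (hT 0) hπ'0, Finset.card_singleton]
  · rintro ⟨a, b, ha, hb, hab, ca, cb⟩
    obtain ⟨d, hd, hda, hdb⟩ := fin4_exists_third a b ha hb hab
    obtain ⟨π, π', hπ0, hπ'0, hpl, h1, h2, h3⟩ :=
      isFace_of_two_singleton_shared hc hT hsum ha hb hd hab (Ne.symm hda) (Ne.symm hdb) ca cb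
    exact ⟨a, b, d, π, π', ha, hb, hd, hab, Ne.symm hda, Ne.symm hdb, hπ0, hπ'0, hpl, h1, h2, h3⟩

/-- In degree 12 (`|G| = 12`) the pairing pattern of a `SumTwo` quadruple sums to `6`. -/
theorem sum_card_shared_of_card_twelve {c : G} (hc : IsComplexConj c) {T : Fin 4 → Finset G}
    (h0 : IsCMType c (T 0)) (hsum : SumTwo T) (h12 : Fintype.card G = 12) :
    (shared T 1).card + (shared T 2).card + (shared T 3).card = 6 := by
  have := h0.two_mul_card hc
  rw [sum_card_shared hsum]
  omega

/-! ### Degrees 6 and 8: two singleton pairings always exist -/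

/-- **Two of the three pairings are singletons when `|G| ≤ 8`** (`|T 0| ≤ 4`, three non-empty parts). -/
theorem exists_singleton_shared_pair {c : G} (hc : IsComplexConj c) {T : Fin 4 → Finset G}
    (hT : ∀ i, IsCMType c (T i)) (hsum : SumTwo T) (hconj : ∀ i, i ≠ 0 → T i ≠ c • T 0)
    (h8 : Fintype.card G ≤ 8) :
    ∃ a b d : Fin 4, a ≠ 0 ∧ b ≠ 0 ∧ d ≠ 0 ∧ a ≠ b ∧ a ≠ d ∧ b ≠ d ∧
      (shared T a).card = 1 ∧ (shared T b).card = 1 := by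
  have hcard := (hT 0).two_mul_card hc
  have hsum3 := sum_card_shared hsum
  have h1 := (shared_nonempty hc (hT 0) (hT 1) (hconj 1 (by decide))).card_pos
  have h2 := (shared_nonempty hc (hT 0) (hT 2) (hconj 2 (by decide))).card_pos
  have h3 := (shared_nonempty hc (hT 0) (hT 3) (hconj 3 (by decide))).card_pos
  rcases (by omega : ((shared T 1).card = 1 ∧ (shared T 2).card = 1) ∨
      ((shared T 1).card = 1 ∧ (shared T 3).card = 1) ∨
      ((shared T 2).card = 1 ∧ (shared T 3).card = 1)) with ⟨e1, e2⟩ | ⟨e1, e2⟩ | ⟨e1, e2⟩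
  · exact ⟨1, 2, 3, by decide, by decide, by decide, by decide, by decide, by decide, e1, e2⟩
  · exact ⟨1, 3, 2, by decide, by decide, by decide, by decide, by decide, by decide, e1, e2⟩
  · exact ⟨2, 3, 1, by decide, by decide, by decide, by decide, by decide, by decide, e1, e2⟩

/-- **Degrees 6 and 8: every `SumTwo` quadruple of CM types with no corner conjugate to the first is a
face `(T 0; π, π′)` up to relabelling its corners** (`route/ROUTE.md` §3.1): there are corners
`a, b, d` (the three corners other than `0`) and embeddings `π, π′ ∈ T 0` at distinct places with
`T a = (T̄ 0)^{(π)}`, `T b = (T̄ 0)^{(π′)}`, `T d = (T 0)^{(ππ′)}` — i.e. `T a, T b, T d` are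
`faceCorners c (T 0) π π' 1, 2, 3`. -/
theorem isFace_of_sumTwo_of_card_le_eight {c : G} (hc : IsComplexConj c) {T : Fin 4 → Finset G}
    (hT : ∀ i, IsCMType c (T i)) (hsum : SumTwo T) (hconj : ∀ i, i ≠ 0 → T i ≠ c • T 0)
    (h8 : Fintype.card G ≤ 8) :
    ∃ (a b d : Fin 4) (π π' : G), a ≠ 0 ∧ b ≠ 0 ∧ d ≠ 0 ∧ a ≠ b ∧ a ≠ d ∧ b ≠ d ∧
      π ∈ T 0 ∧ π' ∈ T 0 ∧ π' ∉ place c π ∧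
      T a = faceCorners c (T 0) π π' 1 ∧ T b = faceCorners c (T 0) π π' 2 ∧
      T d = faceCorners c (T 0) π π' 3 := by
  obtain ⟨a, b, d, ha, hb, hd, hab, had, hbd, ca, cb⟩ :=
    exists_singleton_shared_pair hc hT hsum hconj h8
  obtain ⟨π, π', hπ0, hπ'0, hpl, h1, h2, h3⟩ :=
    isFace_of_two_singleton_shared hc hT hsum ha hb hd hab had hbd ca cb
  exact ⟨a, b, d, π, π', ha, hb, hd, hab, had, hbd, hπ0, hπ'0, hpl, h1, h2, h3⟩

/-- The same with the symmetric hypothesis "no two corners are conjugate". -/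
theorem isFace_of_sumTwo_of_card_le_eight' {c : G} (hc : IsComplexConj c) {T : Fin 4 → Finset G}
    (hT : ∀ i, IsCMType c (T i)) (hsum : SumTwo T) (hconj : ∀ i j, i ≠ j → T j ≠ c • T i)
    (h8 : Fintype.card G ≤ 8) :
    ∃ (a b d : Fin 4) (π π' : G), a ≠ 0 ∧ b ≠ 0 ∧ d ≠ 0 ∧ a ≠ b ∧ a ≠ d ∧ b ≠ d ∧
      π ∈ T 0 ∧ π' ∈ T 0 ∧ π' ∉ place c π ∧
      T a = faceCorners c (T 0) π π' 1 ∧ T b = faceCorners c (T 0) π π' 2 ∧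
      T d = faceCorners c (T 0) π π' 3 :=
  isFace_of_sumTwo_of_card_le_eight hc hT hsum (fun i hi => hconj 0 i (Ne.symm hi)) h8


/-! ### Relabelling the corners -/

/-- The six orderings of three distinct non-zero indices of `Fin 4`. -/
theorem fin4_triples_mem (a b d : Fin 4) (ha : a ≠ 0) (hb : b ≠ 0) (hd : d ≠ 0)
    (hab : a ≠ b) (had : a ≠ d) (hbd : b ≠ d) :
    (a, b, d) ∈ ({(1, 2, 3), (1, 3, 2), (2, 1, 3), (2, 3, 1), (3, 1, 2), (3, 2, 1)} :
      Finset (Fin 4 × Fin 4 × Fin 4)) := by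
  fin_cases a <;> fin_cases b <;> fin_cases d <;> simp_all

/-- `[T 0, T a, T b, T d]` is a permutation of `[T 0, T 1, T 2, T 3]` for distinct non-zero `a, b, d`
(the corner relabelling of `isFace_of_sumTwo_of_card_le_eight`, as a `List.Perm`). -/
theorem perm_fin4 {α : Type*} (T : Fin 4 → α) (a b d : Fin 4) (ha : a ≠ 0) (hb : b ≠ 0)
    (hd : d ≠ 0) (hab : a ≠ b) (had : a ≠ d) (hbd : b ≠ d) :
    [T 0, T a, T b, T d].Perm [T 0, T 1, T 2, T 3] := by
  have h := fin4_triples_mem a b d ha hb hd hab had hbd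
  simp only [Finset.mem_insert, Finset.mem_singleton, Prod.mk.injEq] at h
  rcases h with ⟨h1, h2, h3⟩ | ⟨h1, h2, h3⟩ | ⟨h1, h2, h3⟩ | ⟨h1, h2, h3⟩ | ⟨h1, h2, h3⟩ |
    ⟨h1, h2, h3⟩ <;> subst h1 h2 h3
  · exact List.Perm.refl _
  · exact List.Perm.cons _ (List.Perm.cons _ (List.Perm.swap _ _ _))
  · exact List.Perm.cons _ (List.Perm.swap _ _ _)
  · exact List.Perm.cons _ ((List.Perm.cons _ (List.Perm.swap _ _ _)).trans (List.Perm.swap _ _ _))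
  · exact List.Perm.cons _ ((List.Perm.swap _ _ _).trans (List.Perm.cons _ (List.Perm.swap _ _ _)))
  · exact List.Perm.cons _ ((List.Perm.swap _ _ _).trans
      ((List.Perm.cons _ (List.Perm.swap _ _ _)).trans (List.Perm.swap _ _ _)))

end HodgeRepro
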